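import Literature.Algebra.Lie.OrthogonalSelfAdjointIrreducibleTypeB
import HarnessLib

/-!
# `Sym²₀K³` is an irreducible `𝔰𝔬(3)`-module: the summand `𝔤_+(U)` for `dim U = 3` (Looijenga–Lunts 1997, Appendix (7.5): "The summands are irreducible" — the smallest orthogonal case, `B_1`)

Topic `Literature/Algebra/Lie` (namespace `Literature.Algebra.Lie.OrthogonalSelfAdjointTypeBOne`).  Lane `lit-hodgefound`
(Track 2 foundations library), Layer A1, skeleton seat `lit-hodgefound-skel-1` (generation 50), row **A1-179** of
`run/shared/lean/pub/lit-hodgefound/SKELETON.md`: the case `dim U = 3` that row A1-178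
(`OrthogonalSelfAdjointIrreducibleTypeB.lean`, `dim U = 2l + 1 ≥ 5`) could not reach through the `𝔬(2l)`-block (for `l = 1`
that block is the reducible hyperbolic plane).  Here `|l| = 1` (`[Unique l]`, so that both `typeB Unit K` and the
`typeB (Fin 1) K` of row A1-171's odd hyperbolic bases are covered), the matrices are `3 × 3` with indices
`0 = inl ()`, `1 = inr (inl default)`, `1' = inr (inr default)`, and the argument is the `𝔰𝔩₂`-theory of the
`5`-dimensional module `V(4)` [Humphreys1972, §7.2] done by hand on the five weight vectors.  THEOREMS ONLY; no definition,
no named fact, no `sorry` (net debt `0`); no instance, no notation.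

## Source, VERBATIM (held TeX `paper:arxiv-alg-geom_9604014`, p0028 L86–L90)

> "(7.5) Lemma. Suppose that `U` is not an inner product space of dimension two. Then `𝔤𝔩_-(U) = 𝔞𝔲𝔱(U)` and
> `𝔤𝔩(U) = 𝔤_-(U) ⊕ 𝔤_0(U) ⊕ 𝔤_+(U)` is an `𝔞𝔲𝔱(U)`-invariant decomposition. The summands are irreducible, except when `U`
> is an inner product space of dimension `4`."

For `dim U = 3` (`ε = 1`; `U` is never symplectic in odd dimension): `𝔞𝔲𝔱(U) = 𝔬(3) = typeB l K` (`|l| = 1`; basis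
`h = E_{11} - E_{1'1'}`, `u = E_{01'} - 2E_{10}`, `v = E_{01} - 2E_{1'0}` of row A1-170), and `𝔤_+(U)`, the traceless
`JB`-self-adjoint matrices, is `5`-dimensional with the weight vectors (`h`-weights `2, 1, 0, -1, -2`)
`e₂ = E_{11'}`, `e₁ = E_{01'} + 2E_{10}`, `e₀ = 2E_{00} - E_{11} - E_{1'1'}`, `e₋₁ = E_{01} + 2E_{1'0}`, `e₋₂ = E_{1'1}` (`eq_comb`).

## Proof [Humphreys1972, §7.2]

`[u, e₋₂] = e₋₁`, `[u, e₋₁] = 2e₀`, `[u, e₀] = -3e₁`, `[u, e₁] = -4e₂`, `[u, e₂] = 0` and `[v, e₂] = e₁`, `[v, e₁] = 2e₀`,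
`[v, e₀] = -3e₋₁`, `[v, e₋₁] = -4e₋₂` (§1).  For `X = Σ c_k e_k ≠ 0` in a stable `P` the iterates `(ad u)^j X`
(`u_comm_comb`) end in a NON-ZERO multiple (`24c₋₂`, `24c₋₁`, `12c₀`, `-4c₁` or `c₂`) of the maximal vector `e₂`, so
`e₂ ∈ P` when `2, 3 ≠ 0` (`single_mem_of_ne_zero`); `v` then regenerates `e₁, e₀, e₋₁, e₋₂` (`mem_of_single_mem`), and
these span (`eq_comb`).  The characteristic hypothesis `3 ≠ 0` is necessary (for `char K = 3` the identity of `U` is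
traceless and invariant), `2 ≠ 0` is assumed throughout the lane.

## Contents (all proved)

* §1 the bracket table `u_comm_em2`, `u_comm_em1`, `u_comm_e0`, `u_comm_e1`, `u_comm_e2`, `v_comm_e2`, `v_comm_e1`,
  `v_comm_e0`, `v_comm_em1`; **`u_comm_comb`** (`ad u` on `Σ c_k e_k`); **`eq_comb`** (the five weight vectors span the
  traceless `JB`-self-adjoint matrices, any commutative ring);
* §2 **`single_mem_of_ne_zero`** (the maximal vector lies in every non-zero stable `P`), **`mem_of_single_mem`**
  (it generates), **`eq_bot_or_forall_mem_of_forall_comm_mem`** (the core: `2, 3 ≠ 0`);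
* §3 **`eq_bot_or_eq_of_forall_comm_mem`** (`P ≤ selfAdjointMatricesSubmodule (JB l K) ⊓ ker tr`, `ad typeB`-stable ⇒
  `⊥` or everything), `…_of_charZero`; basis-free **`eq_bot_or_eq_of_forall_lie_mem_of_toMatrix_eq_JB`** (a basis with
  Gram `JB l K`, `|l| = 1`), **`eq_bot_or_eq_of_forall_lie_mem_of_finrank_eq_three`** (algebraically closed `K`, `B`
  non-degenerate symmetric, `dim U = 3`), `…_of_charZero`.

## Scope

With rows A1-174/175 (even `dim ≥ 4`), A1-178 (odd `dim ≥ 5`) and this file (`dim 3`), the orthogonal summand `𝔤_+(U)` of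
(7.5) is irreducible for EVERY non-degenerate symmetric `U` of dimension `≥ 3` over an algebraically closed field of
characteristic `0` (the paper's `ℂ`), and for split forms over any field with `2, 3, dim U, ½dim U` non-zero as
appropriate; `dim U = 2` is the reducible plane (row A1-167).  Real non-split forms are not treated.  Nothing here is a
case of the Hodge conjecture.

## References

* [LooijengaLunts1997] E. Looijenga, V. A. Lunts, *A Lie algebra attached to a projective variety*, Invent. Math. 129
  (1997) 361–412, Appendix Lemma (7.5), p. 28.
* [Humphreys1972] J. E. Humphreys, *Introduction to Lie Algebras and Representation Theory*, GTM 9, Springer 1972,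
  §1.2 p. 3 (type B_ℓ), §7.2 (irreducible `𝔰𝔩₂`-modules `V(m)`), §20.2.
-/

namespace Literature.Algebra.Lie.OrthogonalSelfAdjointTypeBOne

open LieAlgebra LieAlgebra.Orthogonal Matrix Sum

variable {l : Type*} [Fintype l] [DecidableEq l] [Unique l] {R : Type*} [CommRing R] {K : Type*} [Field K]

/-! ### Matrix units of size `3` (indices `0 = inl ()`, `1 = inr (inl default)`, `1' = inr (inr default)`) -/

/-- Matrix units: `E_{pq}E_{rs} = 0` for `q ≠ r`. [folklore] -/
private theorem E_mul_E_of_ne {ι : Type*} [Fintype ι] [DecidableEq ι] {p q r s : ι} (h : q ≠ r) :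
    single p q (1 : R) * single r s (1 : R) = 0 :=
  single_mul_single_of_ne _ _ _ _ h _

/-- Matrix units: `E_{pq}E_{qs} = E_{ps}`. [folklore] -/
private theorem E_mul_E {ι : Type*} [Fintype ι] [DecidableEq ι] (p q s : ι) :
    single p q (1 : R) * single q s (1 : R) = single p s 1 := by
  rw [single_mul_single_same, mul_one]

omit [Fintype l] [DecidableEq l] in
/-- Distinct indices among `0, 1, 1'`. [folklore] -/
private theorem ne01 : (inl () : Unit ⊕ (l ⊕ l)) ≠ inr (inl default) := inl_ne_inr
omit [Fintype l] [DecidableEq l] in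
/-- Distinct indices among `0, 1, 1'`. [folklore] -/
private theorem ne01' : (inl () : Unit ⊕ (l ⊕ l)) ≠ inr (inr default) := inl_ne_inr
omit [Fintype l] [DecidableEq l] in
/-- Distinct indices among `0, 1, 1'`. [folklore] -/
private theorem ne10 : (inr (inl default) : Unit ⊕ (l ⊕ l)) ≠ inl () := inr_ne_inl
omit [Fintype l] [DecidableEq l] in
/-- Distinct indices among `0, 1, 1'`. [folklore] -/
private theorem ne1'0 : (inr (inr default) : Unit ⊕ (l ⊕ l)) ≠ inl () := inr_ne_inl
omit [Fintype l] [DecidableEq l] in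
/-- Distinct indices among `0, 1, 1'`. [folklore] -/
private theorem ne11' : (inr (inl default) : Unit ⊕ (l ⊕ l)) ≠ inr (inr default) := fun h => inl_ne_inr (inr_injective h)
omit [Fintype l] [DecidableEq l] in
/-- Distinct indices among `0, 1, 1'`. [folklore] -/
private theorem ne1'1 : (inr (inr default) : Unit ⊕ (l ⊕ l)) ≠ inr (inl default) := fun h => inr_ne_inl (inr_injective h)

/-! ### §1 The five weight vectors of `𝔤_+ = Sym²₀(3)` and the brackets with `u`, `v` ∈ `𝔬(3)` [Humphreys1972, §7.2, §1.2]

`e₂ = E_{11'}`, `e₁ = E_{01'} + 2E_{10}`, `e₀ = 2E_{00} - E_{11} - E_{1'1'}`, `e₋₁ = E_{01} + 2E_{1'0}`, `e₋₂ = E_{1'1}` have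
`h`-weights `2, 1, 0, -1, -2` (`h = E_{11} - E_{1'1'}`); `u = E_{01'} - 2E_{10}` raises, `v = E_{01} - 2E_{1'0}` lowers:
`[u, e₋₂] = e₋₁`, `[u, e₋₁] = 2e₀`, `[u, e₀] = -3e₁`, `[u, e₁] = -4e₂`, `[u, e₂] = 0`; `[v, e₂] = e₁`, `[v, e₁] = 2e₀`,
`[v, e₀] = -3e₋₁`, `[v, e₋₁] = -4e₋₂` — the `5`-dimensional `𝔰𝔩₂`-module `V(4)`. -/

/-- `[u, e₋₂] = e₋₁`: `u E_{1'1} - E_{1'1} u = E_{01} + 2E_{1'0}`. [cite: Humphreys1972, §7.2 (Lemma: the action of x, y, h on V(m)), §1.2 (type B_ℓ)] -/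
theorem u_comm_em2 :
    (single (inl ()) (inr (inr default)) (1 : R) - (2 : R) • single (inr (inl default)) (inl ()) 1)
        * single (inr (inr default)) (inr (inl default)) (1 : R)
      - single (inr (inr default)) (inr (inl default)) (1 : R)
        * (single (inl ()) (inr (inr default)) (1 : R) - (2 : R) • single (inr (inl default)) (inl ()) 1)
      = (single (inl ()) (inr (inl default)) 1 + (2 : R) • single (inr (inr default)) (inl ()) 1
          : Matrix (Unit ⊕ (l ⊕ l)) (Unit ⊕ (l ⊕ l)) R) := by
  simp only [Matrix.sub_mul, Matrix.mul_sub, Matrix.smul_mul, Matrix.mul_smul, E_mul_E, E_mul_E_of_ne ne01',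
    E_mul_E_of_ne ne10]
  module

/-- `[u, e₋₁] = 2e₀`. [cite: Humphreys1972, §7.2, §1.2 (type B_ℓ)] -/
theorem u_comm_em1 :
    (single (inl ()) (inr (inr default)) (1 : R) - (2 : R) • single (inr (inl default)) (inl ()) 1)
        * (single (inl ()) (inr (inl default)) (1 : R) + (2 : R) • single (inr (inr default)) (inl ()) 1)
      - (single (inl ()) (inr (inl default)) (1 : R) + (2 : R) • single (inr (inr default)) (inl ()) 1)
        * (single (inl ()) (inr (inr default)) (1 : R) - (2 : R) • single (inr (inl default)) (inl ()) 1)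
      = ((2 : R) • ((2 : R) • single (inl ()) (inl ()) 1 - single (inr (inl default)) (inr (inl default)) 1
          - single (inr (inr default)) (inr (inr default)) 1) : Matrix (Unit ⊕ (l ⊕ l)) (Unit ⊕ (l ⊕ l)) R) := by
  simp only [Matrix.sub_mul, Matrix.mul_sub, Matrix.add_mul, Matrix.mul_add, Matrix.smul_mul, Matrix.mul_smul, E_mul_E,
    E_mul_E_of_ne ne01, E_mul_E_of_ne ne01', E_mul_E_of_ne ne10, E_mul_E_of_ne ne1'0]
  module

/-- `[u, e₀] = -3e₁`. [cite: Humphreys1972, §7.2, §1.2 (type B_ℓ)] -/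
theorem u_comm_e0 :
    (single (inl ()) (inr (inr default)) (1 : R) - (2 : R) • single (inr (inl default)) (inl ()) 1)
        * ((2 : R) • single (inl ()) (inl ()) (1 : R) - single (inr (inl default)) (inr (inl default)) 1
            - single (inr (inr default)) (inr (inr default)) 1)
      - ((2 : R) • single (inl ()) (inl ()) (1 : R) - single (inr (inl default)) (inr (inl default)) 1
            - single (inr (inr default)) (inr (inr default)) 1)
        * (single (inl ()) (inr (inr default)) (1 : R) - (2 : R) • single (inr (inl default)) (inl ()) 1)
      = (-((3 : R) • (single (inl ()) (inr (inr default)) 1 + (2 : R) • single (inr (inl default)) (inl ()) 1))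
          : Matrix (Unit ⊕ (l ⊕ l)) (Unit ⊕ (l ⊕ l)) R) := by
  simp only [Matrix.sub_mul, Matrix.mul_sub, Matrix.smul_mul, Matrix.mul_smul, E_mul_E, E_mul_E_of_ne ne01,
    E_mul_E_of_ne ne01', E_mul_E_of_ne ne10, E_mul_E_of_ne ne1'0, E_mul_E_of_ne ne1'1]
  module

/-- `[u, e₁] = -4e₂`. [cite: Humphreys1972, §7.2, §1.2 (type B_ℓ)] -/
theorem u_comm_e1 :
    (single (inl ()) (inr (inr default)) (1 : R) - (2 : R) • single (inr (inl default)) (inl ()) 1)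
        * (single (inl ()) (inr (inr default)) (1 : R) + (2 : R) • single (inr (inl default)) (inl ()) 1)
      - (single (inl ()) (inr (inr default)) (1 : R) + (2 : R) • single (inr (inl default)) (inl ()) 1)
        * (single (inl ()) (inr (inr default)) (1 : R) - (2 : R) • single (inr (inl default)) (inl ()) 1)
      = (-((4 : R) • single (inr (inl default)) (inr (inr default)) 1) : Matrix (Unit ⊕ (l ⊕ l)) (Unit ⊕ (l ⊕ l)) R) := by
  simp only [Matrix.sub_mul, Matrix.mul_sub, Matrix.add_mul, Matrix.mul_add, Matrix.smul_mul, Matrix.mul_smul, E_mul_E,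
    E_mul_E_of_ne ne1'1]
  module

/-- `[v, e₂] = e₁`: `v E_{11'} - E_{11'} v = E_{01'} + 2E_{10}`. [cite: Humphreys1972, §7.2, §1.2 (type B_ℓ)] -/
theorem v_comm_e2 :
    (single (inl ()) (inr (inl default)) (1 : R) - (2 : R) • single (inr (inr default)) (inl ()) 1)
        * single (inr (inl default)) (inr (inr default)) (1 : R)
      - single (inr (inl default)) (inr (inr default)) (1 : R)
        * (single (inl ()) (inr (inl default)) (1 : R) - (2 : R) • single (inr (inr default)) (inl ()) 1)
      = (single (inl ()) (inr (inr default)) 1 + (2 : R) • single (inr (inl default)) (inl ()) 1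
          : Matrix (Unit ⊕ (l ⊕ l)) (Unit ⊕ (l ⊕ l)) R) := by
  simp only [Matrix.sub_mul, Matrix.mul_sub, Matrix.smul_mul, Matrix.mul_smul, E_mul_E, E_mul_E_of_ne ne01,
    E_mul_E_of_ne ne1'0]
  module

/-- `[v, e₁] = 2e₀`. [cite: Humphreys1972, §7.2, §1.2 (type B_ℓ)] -/
theorem v_comm_e1 :
    (single (inl ()) (inr (inl default)) (1 : R) - (2 : R) • single (inr (inr default)) (inl ()) 1)
        * (single (inl ()) (inr (inr default)) (1 : R) + (2 : R) • single (inr (inl default)) (inl ()) 1)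
      - (single (inl ()) (inr (inr default)) (1 : R) + (2 : R) • single (inr (inl default)) (inl ()) 1)
        * (single (inl ()) (inr (inl default)) (1 : R) - (2 : R) • single (inr (inr default)) (inl ()) 1)
      = ((2 : R) • ((2 : R) • single (inl ()) (inl ()) 1 - single (inr (inl default)) (inr (inl default)) 1
          - single (inr (inr default)) (inr (inr default)) 1) : Matrix (Unit ⊕ (l ⊕ l)) (Unit ⊕ (l ⊕ l)) R) := by
  simp only [Matrix.sub_mul, Matrix.mul_sub, Matrix.add_mul, Matrix.mul_add, Matrix.smul_mul, Matrix.mul_smul, E_mul_E,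
    E_mul_E_of_ne ne01, E_mul_E_of_ne ne01', E_mul_E_of_ne ne10, E_mul_E_of_ne ne1'0]
  module

/-- `[v, e₀] = -3e₋₁`. [cite: Humphreys1972, §7.2, §1.2 (type B_ℓ)] -/
theorem v_comm_e0 :
    (single (inl ()) (inr (inl default)) (1 : R) - (2 : R) • single (inr (inr default)) (inl ()) 1)
        * ((2 : R) • single (inl ()) (inl ()) (1 : R) - single (inr (inl default)) (inr (inl default)) 1
            - single (inr (inr default)) (inr (inr default)) 1)
      - ((2 : R) • single (inl ()) (inl ()) (1 : R) - single (inr (inl default)) (inr (inl default)) 1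
            - single (inr (inr default)) (inr (inr default)) 1)
        * (single (inl ()) (inr (inl default)) (1 : R) - (2 : R) • single (inr (inr default)) (inl ()) 1)
      = (-((3 : R) • (single (inl ()) (inr (inl default)) 1 + (2 : R) • single (inr (inr default)) (inl ()) 1))
          : Matrix (Unit ⊕ (l ⊕ l)) (Unit ⊕ (l ⊕ l)) R) := by
  simp only [Matrix.sub_mul, Matrix.mul_sub, Matrix.smul_mul, Matrix.mul_smul, E_mul_E, E_mul_E_of_ne ne01,
    E_mul_E_of_ne ne01', E_mul_E_of_ne ne10, E_mul_E_of_ne ne1'0, E_mul_E_of_ne ne11']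
  module

/-- `[v, e₋₁] = -4e₋₂`. [cite: Humphreys1972, §7.2, §1.2 (type B_ℓ)] -/
theorem v_comm_em1 :
    (single (inl ()) (inr (inl default)) (1 : R) - (2 : R) • single (inr (inr default)) (inl ()) 1)
        * (single (inl ()) (inr (inl default)) (1 : R) + (2 : R) • single (inr (inr default)) (inl ()) 1)
      - (single (inl ()) (inr (inl default)) (1 : R) + (2 : R) • single (inr (inr default)) (inl ()) 1)
        * (single (inl ()) (inr (inl default)) (1 : R) - (2 : R) • single (inr (inr default)) (inl ()) 1)
      = (-((4 : R) • single (inr (inr default)) (inr (inl default)) 1) : Matrix (Unit ⊕ (l ⊕ l)) (Unit ⊕ (l ⊕ l)) R) := by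
  simp only [Matrix.sub_mul, Matrix.mul_sub, Matrix.add_mul, Matrix.mul_add, Matrix.smul_mul, Matrix.mul_smul, E_mul_E,
    E_mul_E_of_ne ne11']
  module

/-- `[u, e₂] = 0` (`e₂ = E_{11'}` is a maximal vector). [cite: Humphreys1972, §7.2, §20.2] -/
theorem u_comm_e2 :
    (single (inl ()) (inr (inr default)) (1 : R) - (2 : R) • single (inr (inl default)) (inl ()) 1) * single (inr (inl default)) (inr (inr default)) (1 : R)
      - single (inr (inl default)) (inr (inr default)) (1 : R) * (single (inl ()) (inr (inr default)) (1 : R) - (2 : R) • single (inr (inl default)) (inl ()) 1)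
      = (0 : Matrix (Unit ⊕ (l ⊕ l)) (Unit ⊕ (l ⊕ l)) R) := by
  simp only [Matrix.sub_mul, Matrix.mul_sub, Matrix.smul_mul, Matrix.mul_smul, E_mul_E_of_ne ne1'1, E_mul_E_of_ne ne01,
    E_mul_E_of_ne ne1'0]
  module

/-- **`ad u` on a combination of the weight vectors**: `[u, Σ c_k e_k] = -4c₁ e₂ - 3c₀ e₁ + 2c₋₁ e₀ + c₋₂ e₋₁`.
[cite: Humphreys1972, §7.2 (Lemma), §20.2] -/
theorem u_comm_comb (c₂ c₁ c₀ cm1 cm2 : R) :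
    (single (inl ()) (inr (inr default)) (1 : R) - (2 : R) • single (inr (inl default)) (inl ()) 1)
        * (c₂ • single (inr (inl default)) (inr (inr default)) (1 : R) + c₁ • (single (inl ()) (inr (inr default)) (1 : R) + (2 : R) • single (inr (inl default)) (inl ()) 1)
        + c₀ • ((2 : R) • single (inl ()) (inl ()) (1 : R) - single (inr (inl default)) (inr (inl default)) 1 - single (inr (inr default)) (inr (inr default)) 1)
        + cm1 • (single (inl ()) (inr (inl default)) (1 : R) + (2 : R) • single (inr (inr default)) (inl ()) 1) + cm2 • single (inr (inr default)) (inr (inl default)) (1 : R) : Matrix (Unit ⊕ (l ⊕ l)) (Unit ⊕ (l ⊕ l)) R)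
      - (c₂ • single (inr (inl default)) (inr (inr default)) (1 : R) + c₁ • (single (inl ()) (inr (inr default)) (1 : R) + (2 : R) • single (inr (inl default)) (inl ()) 1)
        + c₀ • ((2 : R) • single (inl ()) (inl ()) (1 : R) - single (inr (inl default)) (inr (inl default)) 1 - single (inr (inr default)) (inr (inr default)) 1)
        + cm1 • (single (inl ()) (inr (inl default)) (1 : R) + (2 : R) • single (inr (inr default)) (inl ()) 1) + cm2 • single (inr (inr default)) (inr (inl default)) (1 : R) : Matrix (Unit ⊕ (l ⊕ l)) (Unit ⊕ (l ⊕ l)) R)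
        * (single (inl ()) (inr (inr default)) (1 : R) - (2 : R) • single (inr (inl default)) (inl ()) 1)
      = ((-(4 * c₁)) • single (inr (inl default)) (inr (inr default)) (1 : R) + (-(3 * c₀)) • (single (inl ()) (inr (inr default)) (1 : R) + (2 : R) • single (inr (inl default)) (inl ()) 1)
        + (2 * cm1) • ((2 : R) • single (inl ()) (inl ()) (1 : R) - single (inr (inl default)) (inr (inl default)) 1 - single (inr (inr default)) (inr (inr default)) 1)
        + cm2 • (single (inl ()) (inr (inl default)) (1 : R) + (2 : R) • single (inr (inr default)) (inl ()) 1) + (0 : R) • single (inr (inr default)) (inr (inl default)) (1 : R) : Matrix (Unit ⊕ (l ⊕ l)) (Unit ⊕ (l ⊕ l)) R) := by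
  have h2 := u_comm_e2 (l := l) (R := R)
  have h1 := u_comm_e1 (l := l) (R := R)
  have h0 := u_comm_e0 (l := l) (R := R)
  have hm1 := u_comm_em1 (l := l) (R := R)
  have hm2 := u_comm_em2 (l := l) (R := R)
  set u : Matrix (Unit ⊕ (l ⊕ l)) (Unit ⊕ (l ⊕ l)) R := (single (inl ()) (inr (inr default)) (1 : R) - (2 : R) • single (inr (inl default)) (inl ()) 1) with hu
  set e₂ : Matrix (Unit ⊕ (l ⊕ l)) (Unit ⊕ (l ⊕ l)) R := single (inr (inl default)) (inr (inr default)) (1 : R) with he₂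
  set e₁ : Matrix (Unit ⊕ (l ⊕ l)) (Unit ⊕ (l ⊕ l)) R := (single (inl ()) (inr (inr default)) (1 : R) + (2 : R) • single (inr (inl default)) (inl ()) 1) with he₁
  set e₀ : Matrix (Unit ⊕ (l ⊕ l)) (Unit ⊕ (l ⊕ l)) R := ((2 : R) • single (inl ()) (inl ()) (1 : R) - single (inr (inl default)) (inr (inl default)) 1 - single (inr (inr default)) (inr (inr default)) 1) with he₀
  set f₁ : Matrix (Unit ⊕ (l ⊕ l)) (Unit ⊕ (l ⊕ l)) R := (single (inl ()) (inr (inl default)) (1 : R) + (2 : R) • single (inr (inr default)) (inl ()) 1) with hf₁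
  set f₂ : Matrix (Unit ⊕ (l ⊕ l)) (Unit ⊕ (l ⊕ l)) R := single (inr (inr default)) (inr (inl default)) (1 : R) with hf₂
  simp only [Matrix.mul_add, Matrix.add_mul, Matrix.mul_smul, Matrix.smul_mul]
  linear_combination (norm := module) c₂ • h2 + c₁ • h1 + c₀ • h0 + cm1 • hm1 + cm2 • hm2

section coords

variable {X : Matrix (Unit ⊕ (l ⊕ l)) (Unit ⊕ (l ⊕ l)) R}

/-- **The five weight vectors span `𝔤_+ = Sym²₀(3)`**: a traceless `JB`-self-adjoint `3 × 3` matrix is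
`X = X_{11'} e₂ + X_{01'} e₁ - X_{11} e₀ + X_{01} e₋₁ + X_{1'1} e₋₂` (using `X_{10} = 2X_{01'}`, `X_{1'0} = 2X_{01}`,
`X_{1'1'} = X_{11}`, `X_{00} = -2X_{11}`). [cite: Humphreys1972, §1.2 p. 3 (type B_ℓ), §7.2] [cite: LooijengaLunts1997, Appendix (7.5), p. 28] -/
theorem eq_comb (hX : (JB l R).IsSelfAdjoint X) (htr : Matrix.trace X = 0) :
    X = (X (inr (inl default)) (inr (inr default)) • single (inr (inl default)) (inr (inr default)) (1 : R) + X (inl ()) (inr (inr default)) • (single (inl ()) (inr (inr default)) (1 : R) + (2 : R) • single (inr (inl default)) (inl ()) 1)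
        + (-X (inr (inl default)) (inr (inl default))) • ((2 : R) • single (inl ()) (inl ()) (1 : R) - single (inr (inl default)) (inr (inl default)) 1 - single (inr (inr default)) (inr (inr default)) 1)
        + X (inl ()) (inr (inl default)) • (single (inl ()) (inr (inl default)) (1 : R) + (2 : R) • single (inr (inr default)) (inl ()) 1) + X (inr (inr default)) (inr (inl default)) • single (inr (inr default)) (inr (inl default)) (1 : R) : Matrix (Unit ⊕ (l ⊕ l)) (Unit ⊕ (l ⊕ l)) R) := by
  have h10 := OrthogonalSelfAdjointTypeB.apply_inr_inl_inl hX default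
  have h1'0 := OrthogonalSelfAdjointTypeB.apply_inr_inr_inl hX default
  have h1'1' := OrthogonalSelfAdjointTypeB.apply_inr_inr_inr_inr hX default default
  have h00 : X (inl ()) (inl ()) = -(2 * X (inr (inl default)) (inr (inl default))) := by
    have h := OrthogonalSelfAdjointTypeB.trace_eq hX
    rw [htr, Fintype.sum_unique] at h
    linear_combination -h
  ext p q
  rcases p with ⟨⟩ | (a | a) <;> rcases q with ⟨⟩ | (b | b) <;>
    (try obtain rfl : a = default := Subsingleton.elim _ _) <;>
    (try obtain rfl : b = default := Subsingleton.elim _ _) <;>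
    simp [h10, h1'0, h1'1', h00] <;> ring

end coords

/-! ### §2 An `ad 𝔬(3)`-stable subspace of `𝔤_+`: the maximal vector `e₂ = E_{11'}` lies in it, and generates -/

section stable

variable {P : Submodule K (Matrix (Unit ⊕ (l ⊕ l)) (Unit ⊕ (l ⊕ l)) K)}

/-- **Extraction of the maximal vector**: if `P` is stable under `ad 𝔬(3)` (`= typeB`, `|l| = 1`), consists of traceless
`JB`-self-adjoint matrices and contains `X ≠ 0`, then `E_{11'} ∈ P` (`2, 3 ≠ 0` in `K`): with `X = Σ c_k e_k`, the iterates
`(ad u)^j X` are `-4c₁e₂ + …`, `12c₀e₂ + …`, `24c₋₁e₂ + …`, `24c₋₂e₂`, and the last non-zero coordinate from below is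
reached by a pure multiple of `e₂`. [cite: Humphreys1972, §7.2 (V(m) is irreducible: apply x to reach a maximal vector), §20.2] -/
theorem single_mem_of_ne_zero (h2 : (2 : K) ≠ 0) (h3 : (3 : K) ≠ 0)
    (hP : ∀ ⦃Y m : Matrix (Unit ⊕ (l ⊕ l)) (Unit ⊕ (l ⊕ l)) K⦄, Y ∈ typeB l K → m ∈ P → Y * m - m * Y ∈ P)
    (hPS : ∀ ⦃m : Matrix (Unit ⊕ (l ⊕ l)) (Unit ⊕ (l ⊕ l)) K⦄, m ∈ P → (JB l K).IsSelfAdjoint m)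
    (hPT : ∀ ⦃m : Matrix (Unit ⊕ (l ⊕ l)) (Unit ⊕ (l ⊕ l)) K⦄, m ∈ P → Matrix.trace m = 0)
    {X : Matrix (Unit ⊕ (l ⊕ l)) (Unit ⊕ (l ⊕ l)) K} (hXP : X ∈ P) (hX0 : X ≠ 0) :
    (single (inr (inl default)) (inr (inr default)) (1 : K) : Matrix (Unit ⊕ (l ⊕ l)) (Unit ⊕ (l ⊕ l)) K) ∈ P := by
  have hu := OrthogonalSimpleTypeB.usub_mem_typeB (R := K) (l := l) default
  have hsm : ∀ {c : K}, c ≠ 0 → c • (single (inr (inl default)) (inr (inr default)) (1 : K) : Matrix (Unit ⊕ (l ⊕ l)) (Unit ⊕ (l ⊕ l)) K) ∈ P → (single (inr (inl default)) (inr (inr default)) (1 : K) : Matrix (Unit ⊕ (l ⊕ l)) (Unit ⊕ (l ⊕ l)) K) ∈ P :=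
    fun hc h => (P.smul_mem_iff hc).1 h
  have h4 : (2 : K) * 2 ≠ 0 := mul_ne_zero h2 h2
  -- coordinates of `X`
  set c₂ : K := X (inr (inl default)) (inr (inr default)) with hc₂
  set c₁ : K := X (inl ()) (inr (inr default)) with hc₁
  set cm1 : K := X (inl ()) (inr (inl default)) with hcm1
  set cm2 : K := X (inr (inr default)) (inr (inl default)) with hcm2
  set c₀ : K := -X (inr (inl default)) (inr (inl default)) with hc₀
  have hXc : X = (c₂ • single (inr (inl default)) (inr (inr default)) (1 : K) + c₁ • (single (inl ()) (inr (inr default)) (1 : K) + (2 : K) • single (inr (inl default)) (inl ()) 1)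
        + c₀ • ((2 : K) • single (inl ()) (inl ()) (1 : K) - single (inr (inl default)) (inr (inl default)) 1 - single (inr (inr default)) (inr (inr default)) 1)
        + cm1 • (single (inl ()) (inr (inl default)) (1 : K) + (2 : K) • single (inr (inr default)) (inl ()) 1) + cm2 • single (inr (inr default)) (inr (inl default)) (1 : K) : Matrix (Unit ⊕ (l ⊕ l)) (Unit ⊕ (l ⊕ l)) K) := by
    rw [hc₂, hc₁, hc₀, hcm1, hcm2]
    exact eq_comb (hPS hXP) (hPT hXP)
  -- the iterates `(ad u)^j X`
  have hX1 := hP hu hXP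
  rw [hXc, u_comm_comb] at hX1
  have hX2 := hP hu hX1
  rw [u_comm_comb] at hX2
  have hX3 := hP hu hX2
  rw [u_comm_comb] at hX3
  have hX4 := hP hu hX3
  rw [u_comm_comb] at hX4
  by_cases hz2 : cm2 ≠ 0
  · simp only [mul_zero, neg_zero, zero_smul, add_zero] at hX4
    refine hsm ?_ hX4
    have e : -(4 * -(3 * (2 * cm2))) = (2 : K) * 2 * (2 * 3) * cm2 := by ring
    rw [e]
    exact mul_ne_zero (mul_ne_zero h4 (mul_ne_zero h2 h3)) hz2
  rw [not_ne_iff] at hz2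
  rw [hz2] at hX3
  by_cases hz1 : cm1 ≠ 0
  · simp only [mul_zero, neg_zero, zero_smul, add_zero] at hX3
    refine hsm ?_ hX3
    have e : -(4 * -(3 * (2 * cm1))) = (2 : K) * 2 * (2 * 3) * cm1 := by ring
    rw [e]
    exact mul_ne_zero (mul_ne_zero h4 (mul_ne_zero h2 h3)) hz1
  rw [not_ne_iff] at hz1
  rw [hz1, hz2] at hX2
  by_cases hz0 : c₀ ≠ 0
  · simp only [mul_zero, neg_zero, zero_smul, add_zero] at hX2
    refine hsm ?_ hX2
    have e : -(4 * -(3 * c₀)) = (2 : K) * 2 * 3 * c₀ := by ring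
    rw [e]
    exact mul_ne_zero (mul_ne_zero h4 h3) hz0
  rw [not_ne_iff] at hz0
  rw [hz0, hz1, hz2] at hX1
  by_cases hz : c₁ ≠ 0
  · simp only [mul_zero, neg_zero, zero_smul, add_zero] at hX1
    refine hsm ?_ hX1
    exact neg_ne_zero.2 (mul_ne_zero (by rw [show (4 : K) = 2 * 2 by norm_num]; exact h4) hz)
  rw [not_ne_iff] at hz
  rw [hz, hz0, hz1, hz2] at hXc
  simp only [zero_smul, add_zero] at hXc
  have hc2 : c₂ ≠ 0 := by
    rintro h
    rw [h, zero_smul] at hXc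
    exact hX0 hXc
  rw [hXc] at hXP
  exact hsm hc2 hXP

/-- **Generation from the maximal vector**: if `P` is stable under `ad 𝔬(3)` and contains `e₂ = E_{11'}`, then it contains
`e₁ = [v, e₂]`, `e₀ = ½[v, e₁]`, `e₋₁ = -⅓[v, e₀]`, `e₋₂ = -¼[v, e₋₁]` (`2, 3 ≠ 0`), hence every traceless `JB`-self-adjoint
matrix. [cite: Humphreys1972, §7.2, §20.2 (standard cyclic modules)] [cite: LooijengaLunts1997, Appendix (7.5), p. 28 L89] -/
theorem mem_of_single_mem (h2 : (2 : K) ≠ 0) (h3 : (3 : K) ≠ 0)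
    (hP : ∀ ⦃Y m : Matrix (Unit ⊕ (l ⊕ l)) (Unit ⊕ (l ⊕ l)) K⦄, Y ∈ typeB l K → m ∈ P → Y * m - m * Y ∈ P)
    (he : (single (inr (inl default)) (inr (inr default)) (1 : K) : Matrix (Unit ⊕ (l ⊕ l)) (Unit ⊕ (l ⊕ l)) K) ∈ P)
    {X : Matrix (Unit ⊕ (l ⊕ l)) (Unit ⊕ (l ⊕ l)) K} (hX : (JB l K).IsSelfAdjoint X) (htr : Matrix.trace X = 0) : X ∈ P := by
  have hv := OrthogonalSimpleTypeB.vsub_mem_typeB (R := K) (l := l) default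
  have h₁ : ((single (inl ()) (inr (inr default)) (1 : K) + (2 : K) • single (inr (inl default)) (inl ()) 1) : Matrix (Unit ⊕ (l ⊕ l)) (Unit ⊕ (l ⊕ l)) K) ∈ P := by
    have h := hP hv he
    rwa [v_comm_e2] at h
  have h₀ : (((2 : K) • single (inl ()) (inl ()) (1 : K) - single (inr (inl default)) (inr (inl default)) 1 - single (inr (inr default)) (inr (inr default)) 1) : Matrix (Unit ⊕ (l ⊕ l)) (Unit ⊕ (l ⊕ l)) K) ∈ P := by
    have h := hP hv h₁
    rw [v_comm_e1] at h
    exact (P.smul_mem_iff h2).1 h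
  have hm₁ : ((single (inl ()) (inr (inl default)) (1 : K) + (2 : K) • single (inr (inr default)) (inl ()) 1) : Matrix (Unit ⊕ (l ⊕ l)) (Unit ⊕ (l ⊕ l)) K) ∈ P := by
    have h := hP hv h₀
    rw [v_comm_e0, P.neg_mem_iff] at h
    exact (P.smul_mem_iff h3).1 h
  have hm₂ : (single (inr (inr default)) (inr (inl default)) (1 : K) : Matrix (Unit ⊕ (l ⊕ l)) (Unit ⊕ (l ⊕ l)) K) ∈ P := by
    have h := hP hv hm₁
    rw [v_comm_em1, P.neg_mem_iff] at h
    exact (P.smul_mem_iff (by rw [show (4 : K) = 2 * 2 by norm_num]; exact mul_ne_zero h2 h2)).1 h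
  rw [eq_comb hX htr]
  exact P.add_mem (P.add_mem (P.add_mem (P.add_mem (P.smul_mem _ he) (P.smul_mem _ h₁)) (P.smul_mem _ h₀))
    (P.smul_mem _ hm₁)) (P.smul_mem _ hm₂)

/-- **The elementary core** (`B_1`, `dim U = 3`): for `2, 3 ≠ 0` in `K`, a `K`-subspace `P` of TRACELESS `JB`-SELF-ADJOINT
`3 × 3` matrices stable under `m ↦ Ym - mY` for all `Y ∈ 𝔬(3) = typeB l K` (`|l| = 1`) is `0` or contains every traceless
`JB`-self-adjoint matrix — `Sym²₀K³ ≅ V(4)` is an irreducible `𝔰𝔬(3) ≅ 𝔰𝔩₂`-module (characteristic `≠ 2, 3`; for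
`char K = 3` the identity of `U` is traceless and spans a stable line, so the hypothesis `3 ≠ 0` is necessary).
[cite: LooijengaLunts1997, Appendix (7.5), p. 28 L89 ("The summands are irreducible")] [cite: Humphreys1972, §7.2 (Theorem: V(m) irreducible)] -/
theorem eq_bot_or_forall_mem_of_forall_comm_mem (h2 : (2 : K) ≠ 0) (h3 : (3 : K) ≠ 0)
    (hP : ∀ ⦃Y m : Matrix (Unit ⊕ (l ⊕ l)) (Unit ⊕ (l ⊕ l)) K⦄, Y ∈ typeB l K → m ∈ P → Y * m - m * Y ∈ P)
    (hPS : ∀ ⦃m : Matrix (Unit ⊕ (l ⊕ l)) (Unit ⊕ (l ⊕ l)) K⦄, m ∈ P → (JB l K).IsSelfAdjoint m)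
    (hPT : ∀ ⦃m : Matrix (Unit ⊕ (l ⊕ l)) (Unit ⊕ (l ⊕ l)) K⦄, m ∈ P → Matrix.trace m = 0) :
    P = ⊥ ∨ ∀ ⦃X : Matrix (Unit ⊕ (l ⊕ l)) (Unit ⊕ (l ⊕ l)) K⦄, (JB l K).IsSelfAdjoint X → Matrix.trace X = 0 → X ∈ P := by
  by_cases hbot : P = ⊥
  · exact Or.inl hbot
  right
  obtain ⟨X, hXP, hX0⟩ := (Submodule.ne_bot_iff P).1 hbot
  have he := single_mem_of_ne_zero h2 h3 hP hPS hPT hXP hX0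
  intro Y hY hYtr
  exact mem_of_single_mem h2 h3 hP he hY hYtr

end stable

/-! ### §3 The subspace statement and the basis-free transport (`dim U = 3`) -/

/-- **Looijenga–Lunts (7.5), "the summands are irreducible" — `𝔤_+(U)` for `dim U = 3`, in matrices**: for `s = JB`
of size `3` (`|l| = 1`), `2, 3 ≠ 0` in `K`, every `K`-subspace `P ⊆ 𝔤_+ = {X : Xᵀs = sX, tr X = 0}` stable under
`X ↦ AX - XA` for all `A ∈ 𝔬(3) = typeB l K` is `⊥` or `𝔤_+`. [cite: LooijengaLunts1997, Appendix (7.5), p. 28 L86–L90] [cite: Humphreys1972, §7.2] -/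
theorem eq_bot_or_eq_of_forall_comm_mem (h2 : (2 : K) ≠ 0) (h3 : (3 : K) ≠ 0)
    {P : Submodule K (Matrix (Unit ⊕ (l ⊕ l)) (Unit ⊕ (l ⊕ l)) K)}
    (hle : P ≤ selfAdjointMatricesSubmodule (JB l K) ⊓ LinearMap.ker (Matrix.traceLinearMap (Unit ⊕ (l ⊕ l)) K K))
    (hP : ∀ A ∈ typeB l K, ∀ X ∈ P, A * X - X * A ∈ P) :
    P = ⊥ ∨ P = selfAdjointMatricesSubmodule (JB l K) ⊓ LinearMap.ker (Matrix.traceLinearMap (Unit ⊕ (l ⊕ l)) K K) := by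
  have hPS : ∀ ⦃m : Matrix (Unit ⊕ (l ⊕ l)) (Unit ⊕ (l ⊕ l)) K⦄, m ∈ P → (JB l K).IsSelfAdjoint m :=
    fun m hm => ((OrthogonalSelfAdjointTypeB.mem_selfAdjoint_inf_ker_trace_iff m).1 (hle hm)).1
  have hPT : ∀ ⦃m : Matrix (Unit ⊕ (l ⊕ l)) (Unit ⊕ (l ⊕ l)) K⦄, m ∈ P → Matrix.trace m = 0 :=
    fun m hm => ((OrthogonalSelfAdjointTypeB.mem_selfAdjoint_inf_ker_trace_iff m).1 (hle hm)).2
  rcases eq_bot_or_forall_mem_of_forall_comm_mem h2 h3 (fun Y m hY hm => hP Y hY m hm) hPS hPT with h | h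
  · exact Or.inl h
  · right
    refine le_antisymm hle fun X hX => ?_
    obtain ⟨hXs, hXt⟩ := (OrthogonalSelfAdjointTypeB.mem_selfAdjoint_inf_ker_trace_iff X).1 hX
    exact h hXs hXt

/-- The same in characteristic `0`. [cite: LooijengaLunts1997, Appendix (7.5), p. 28 L86–L90] -/
theorem eq_bot_or_eq_of_forall_comm_mem_of_charZero [CharZero K] {P : Submodule K (Matrix (Unit ⊕ (l ⊕ l)) (Unit ⊕ (l ⊕ l)) K)}
    (hle : P ≤ selfAdjointMatricesSubmodule (JB l K) ⊓ LinearMap.ker (Matrix.traceLinearMap (Unit ⊕ (l ⊕ l)) K K))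
    (hP : ∀ A ∈ typeB l K, ∀ X ∈ P, A * X - X * A ∈ P) :
    P = ⊥ ∨ P = selfAdjointMatricesSubmodule (JB l K) ⊓ LinearMap.ker (Matrix.traceLinearMap (Unit ⊕ (l ⊕ l)) K K) :=
  eq_bot_or_eq_of_forall_comm_mem two_ne_zero three_ne_zero hle hP

section Transport

variable {V : Type*} [AddCommGroup V] [Module K V] {B : LinearMap.BilinForm K V}

open Module in
/-- **A basis with Gram matrix `JB l K`, `|l| = 1` (`dim U = 3`, the vector of square `2` and one hyperbolic pair), any field
with `2, 3 ≠ 0`**: every `ad(𝔰𝔬(U, B))`-stable `K`-subspace of `𝔤_+(U) = sym_B(U) ∩ 𝔰𝔩(U)` is `⊥` or `𝔤_+(U)`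
(rows A1-175's transport core). [cite: LooijengaLunts1997, Appendix (7.5), p. 28 L86–L90] [cite: Humphreys1972, §1.2 p. 3, §7.2] -/
theorem eq_bot_or_eq_of_forall_lie_mem_of_toMatrix_eq_JB [NeZero (2 : K)] (h3 : (3 : K) ≠ 0)
    (b : Basis (Unit ⊕ (l ⊕ l)) K V) (hb : LinearMap.BilinForm.toMatrix b B = JB l K)
    {P : Submodule K (Module.End K V)} (hP : P ≤ B.selfAdjointSubmodule ⊓ LinearMap.ker (LinearMap.trace K V))
    (hstab : ∀ a ∈ B.skewAdjointSubmodule, ∀ x ∈ P, ⁅a, x⁆ ∈ P) :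
    P = ⊥ ∨ P = B.selfAdjointSubmodule ⊓ LinearMap.ker (LinearMap.trace K V) := by
  refine OrthogonalSelfAdjointTypeD.eq_bot_or_eq_of_core b (fun P' hst hsa htr ↦ ?_) hP hstab
  rw [hb] at hst hsa ⊢
  exact eq_bot_or_forall_mem_of_forall_comm_mem (P := P') (NeZero.ne 2) h3
    (fun Y n hY hn ↦ hst ((OrthogonalAlgebraSimple.isSkewAdjoint_JB_iff_mem_typeB Y).2 hY) hn) hsa htr

open Module in
/-- **`dim U = 3` over an algebraically closed field** (`2, 3 ≠ 0`; e.g. `K = ℂ`): for a non-degenerate symmetric `B` on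
a `3`-dimensional `U`, the `5`-dimensional space `𝔤_+(U)` of traceless `B`-self-adjoint operators has no proper non-zero
`ad(𝔰𝔬(U, B))`-stable subspace — through row A1-171's `exists_basis_toMatrix_eq_JB` (`m = 1`).  This closes the
case `dim U = 3` left open by `OrthogonalSelfAdjointIrreducibleTypeB.lean`.
[cite: LooijengaLunts1997, Appendix (7.5), p. 28 L86–L90 ("The summands are irreducible")] [cite: Humphreys1972, §7.2] -/
theorem eq_bot_or_eq_of_forall_lie_mem_of_finrank_eq_three [IsAlgClosed K] [NeZero (2 : K)] [FiniteDimensional K V]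
    (h3 : (3 : K) ≠ 0)
    (hB : B.Nondegenerate) (hs : ∀ u v : V, B u v = B v u) (hdim : finrank K V = 3)
    {P : Submodule K (Module.End K V)} (hP : P ≤ B.selfAdjointSubmodule ⊓ LinearMap.ker (LinearMap.trace K V))
    (hstab : ∀ a ∈ B.skewAdjointSubmodule, ∀ x ∈ P, ⁅a, x⁆ ∈ P) :
    P = ⊥ ∨ P = B.selfAdjointSubmodule ⊓ LinearMap.ker (LinearMap.trace K V) := by
  obtain ⟨b, hb⟩ := OrthogonalAlgebraSimple.exists_basis_toMatrix_eq_JB hB hs (m := 1) (by rw [hdim])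
  exact eq_bot_or_eq_of_forall_lie_mem_of_toMatrix_eq_JB h3 b hb hP hstab

open Module in
/-- The same in characteristic `0` (the paper's `K = ℂ`). [cite: LooijengaLunts1997, Appendix (7.5), p. 28 L86–L90] -/
theorem eq_bot_or_eq_of_forall_lie_mem_of_finrank_eq_three_of_charZero [IsAlgClosed K] [CharZero K]
    [FiniteDimensional K V]
    (hB : B.Nondegenerate) (hs : ∀ u v : V, B u v = B v u) (hdim : finrank K V = 3)
    {P : Submodule K (Module.End K V)} (hP : P ≤ B.selfAdjointSubmodule ⊓ LinearMap.ker (LinearMap.trace K V))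
    (hstab : ∀ a ∈ B.skewAdjointSubmodule, ∀ x ∈ P, ⁅a, x⁆ ∈ P) :
    P = ⊥ ∨ P = B.selfAdjointSubmodule ⊓ LinearMap.ker (LinearMap.trace K V) :=
  eq_bot_or_eq_of_forall_lie_mem_of_finrank_eq_three three_ne_zero hB hs hdim hP hstab

end Transport

end Literature.Algebra.Lie.OrthogonalSelfAdjointTypeBOne
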